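import Summits.BirchSwinnertonDyer.Rank1Residual.X11b.BDPRouteTwistCertificateCha
import HarnessLib

/-!
# Class X11b, route p2: the twist certificate IN THE CENSUS COLUMN — `#Ш_an(E^{d_K})` a `p`-adic
# unit (cell `b2b-bsdres`, sub-cell `multr1-p2`, gen 22, file 5)

HONEST FRAMING (cell `b2b-bsdres`, run/shared/lean/b2b/bsd-rank1-residual/, verbatim in every
file): the goal of the cell is to DELETE the COMBINATION-SHAPED residual classes of the
Birch–Swinnerton-Dyer formula for ALL analytic-rank `≤ 1` elliptic curves over `ℚ` — "full BSD
formula for every rank `≤ 1` curve in class `C`" assembled STRICTLY from published theorems — so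
that the rank-`≤ 1` remainder becomes exactly the CONSTRUCTION-SHAPED classes, which are TYPED
(missing-input `Prop`s), NOT attempted. This is not "finishing BSD". Sub-cell `multr1-p2` is a
RESEARCH ROUTE on class X11b (`ClassX11b W p := r_an = 1 ∧ p ≠ 2 ∧ mult(p) ∧ irr(p)`,
`Partition/Rows.lean`); no claim beyond the stated class and loci; X11b's label does not change;
NOTHING is booked by this file (how `#Ш_an` of a twist is certified is lane business; census
output is EVIDENCE, never a cited fact).

THEOREMS ONLY (no definition, no named fact, no `sorry`).

WHAT. Gen 22 files 1–4 phrase the twist certificate as "the algebraic central value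
`q_d = L(E^{d_K},1)/Ω(Wd)` of a globally minimal model `Wd` of `E^{d_K}` is a non-zero `p`-adic
unit". The census lanes tabulate instead `#Ш_an(E^d)` (PARI `ellL1 / ellbsd`, Cremona's `S`). This
file states the certificate in THAT column: for a rank-zero twist `Wd` with `E[p]` irreducible
(`p ∤ #Wd(ℚ)_tors`) and `p ∤ ∏c(Wd)` (automatic at a Heegner field for `p ≥ 5` when `p ∤ ∏c(E)`),
`q_d = #Ш_an(Wd)·∏c(Wd)/#Wd(ℚ)_tors²` (GZK: `Reg(Wd) = 1`), so `ord_p q_d = ord_p #Ш_an(Wd)` and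
"`q_d` unit" ⟺ "`#Ш_an(Wd)` unit" (§1 `exists_twistValue_of_shaAn_unit`). Consequences (§2–§3),
all per pair, CONDITIONAL on the named facts in each signature, nothing booked:
`missingUpperBoundAt_of_classX11b_of_twistShaAnUnit_of_cha` (X11b ∧ `p ≥ 5` ∧ `p ∤ ∏c(E)` + a
Heegner field `K` with `d_K < -4` + a globally minimal model `Wd` of `E^{d_K}` with
`ord_{s=1}L(Wd,s) = 0` and `#Ш_an(Wd) = s_d ∈ ℚ`, `ord_p s_d = 0` ⟹ the Euler-system half, NO
surjectivity), `P2.bsdp_and_bsdp_twist_of_openInputAt_of_twistShaAnUnit` (+ `Surj` + THE open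
input ⟹ `BSD(E,p) ∧ BSD(Wd,p)`), `bsdp_of_classX11b_of_twistShaAnUnit_of_padicValRat_shaAn_le_of_cha`
(+ `ord_p #Ш(E)_an ≤ 0` ⟹ `BSD(E,p)`, no open input). EVIDENCE (kit job j126194 of this seat,
HOME/b2b-bsdres-multr1-p2/tcjob/window/): all 6 473 in-window ¬(ram) pairs with `p ∤ ∏c(E)`
(`N < 2·10⁴`) have a Heegner `d` with `|d| ≤ 671`, `L(E^d,1) ≠ 0` and `p ∤ #Ш_an(E^d)`.
References: [Cha2005] Thm. 21; [McCallumLMS1991] §1 Theorem (Kolyvagin); [Miller2011LMS] §1,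
Def. 1.1, Thm. 5.2; [JetchevSkinnerWan2017] §7.4.1; [GrossZagier1986] I (6.5); [SilvermanAEC2009]
VIII.9 (regulator), C.16.
-/

noncomputable section

open scoped Classical NumberField

open WeierstrassCurve NumberField IsDedekindDomain Field
open Literature.NumberTheory.EllipticCurves Literature.NumberTheory.EllipticCurves.GreenbergSelmer
  Literature.NumberTheory.EllipticCurves.ModularForms
  Literature.NumberTheory.EllipticCurves.Rank1Residual
  Literature.NumberTheory.EllipticCurves.Rank1Residual.Typed
  Literature.NumberTheory.EllipticCurves.Cha2005
  Literature.NumberTheory.EllipticCurves.Wuthrich2014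
  Literature.NumberTheory.QuadraticFields.Quadratic
  Literature.NumberTheory.Automorphic
  Literature.NumberTheory.GaloisRepresentations Literature.NumberTheory.GaloisCohomology

namespace Summit.BirchSwinnertonDyer.Rank1Residual.X11b

/-! ### §1. Rank-zero bookkeeping: `q_d` unit ⟺ `#Ш_an(Wd)` unit -/

/-- **For a rank-zero `Wd/ℚ` with `p ∤ #Wd(ℚ)_tors` (irreducible `E[p]`) and `p ∤ ∏c(Wd)`: if
`#Ш_an(Wd) = s_d ∈ ℚ` is a `p`-adic unit then the algebraic central value
`q_d = L(Wd,1)/Ω(Wd) = s_d·∏c(Wd)/#Wd(ℚ)_tors²` is a NON-ZERO rational `p`-adic unit.** (GZK: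
`rank Wd(ℚ) = 0`, so `Reg(Wd) = 1`; `L(Wd,1) ≠ 0`.) Bookkeeping; nothing booked.
[cite: Miller2011LMS, §1 (arXiv:1010.2431 p. 3)] [cite: SilvermanAEC2009, §VIII.9 (p. 253), C.16] -/
theorem exists_twistValue_of_shaAn_unit (Wd : WeierstrassCurve ℚ) [Wd.IsElliptic] (p : ℕ)
    [Fact p.Prime] (hGZK : rank_eq_analyticRank_of_analyticRank_le_one)
    (hmod : hasEntireLFunction_rat) (hrd : Wd.analyticRank = 0)
    (hirrd : Wd.HasIrreducibleModPGaloisRep p) (htamd : padicValNat p Wd.tamagawaProduct = 0)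
    {sd : ℚ} (hsd : shaAn Wd = (sd : ℂ)) (hvsd : padicValRat p sd = 0) :
    ∃ qd : ℚ, Wd.entireLFunction 1 / (Wd.realPeriodRat : ℂ) = (qd : ℂ) ∧ qd ≠ 0 ∧
      padicValRat p qd = 0 := by
  have hr0 : Wd.mordellWeilRank = 0 := (hGZK Wd (by omega)).1.trans hrd
  have hReg : Wd.regulator = 1 := Wd.regulator_eq_one_of_rank_zero hr0
  have hΩ : (Wd.realPeriodRat : ℂ) ≠ 0 :=
    Complex.ofReal_ne_zero.mpr Wd.realPeriodRat_pos_holds.ne'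
  have hc : 0 < Wd.tamagawaProduct := Wd.tamagawaProduct_pos'
  have hT : 0 < Wd.torsionOrder := Wd.torsionOrder_pos_holds
  have hL1 : Wd.entireLFunction 1 ≠ 0 := (Wd.analyticRank_eq_zero_iff_holds (hmod Wd)).1 hrd
  have hcC : ((Wd.tamagawaProduct : ℕ) : ℂ) ≠ 0 := by exact_mod_cast hc.ne'
  have hTC : ((Wd.torsionOrder : ℕ) : ℂ) ≠ 0 := by exact_mod_cast hT.ne'
  have hcQ : ((Wd.tamagawaProduct : ℕ) : ℚ) ≠ 0 := by exact_mod_cast hc.ne'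
  have hTQ : ((Wd.torsionOrder : ℕ) : ℚ) ≠ 0 := by exact_mod_cast hT.ne'
  -- unfold `#Ш_an(Wd)` in rank zero
  have h := hsd
  rw [shaAn_def, Wd.leadingLCoeff_eq_of_analyticRank_eq_zero hrd, hReg, Complex.ofReal_one,
    mul_one] at h
  -- `L(Wd,1) = s_d · Ω · ∏c / tors²`
  have hL : Wd.entireLFunction 1 =
      (sd : ℂ) * (Wd.realPeriodRat : ℂ) * (Wd.tamagawaProduct : ℂ) / (Wd.torsionOrder : ℂ) ^ 2 := by
    rw [← h]
    field_simp
  have hsd0 : sd ≠ 0 := by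
    rintro rfl
    apply hL1
    rw [hL]
    simp
  refine ⟨sd * (Wd.tamagawaProduct : ℚ) / (Wd.torsionOrder : ℚ) ^ 2, ?_, ?_, ?_⟩
  · rw [hL]
    push_cast
    field_simp
  · exact div_ne_zero (mul_ne_zero hsd0 hcQ) (pow_ne_zero 2 hTQ)
  · have htors : padicValNat p Wd.torsionOrder = 0 :=
      padicValNat_torsionOrder_eq_zero_of_irreducible Wd p hirrd
    rw [padicValRat.div (mul_ne_zero hsd0 hcQ) (pow_ne_zero 2 hTQ), padicValRat.mul hsd0 hcQ,
      padicValRat.pow, padicValRat.of_nat, padicValRat.of_nat, hvsd, htors, htamd]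
    simp

/-! ### §2. X11b, `p ≥ 5`: the Euler-system half from "`#Ш_an(E^{d_K})` is a `p`-adic unit" -/

section Pair

variable (W : WeierstrassCurve ℚ) [W.IsElliptic] [W.IsGloballyMinimal] (p : ℕ) [Fact p.Prime]

/-- **X11b ∧ `p ≥ 5` ∧ `p ∤ ∏_ℓ c_ℓ(E)` (NO surjectivity), a Heegner field `K` with `d_K < -4`, a
globally minimal model `Wd` of `E^{d_K}` with `ord_{s=1} L(Wd,s) = 0` and `#Ш_an(Wd) = s_d` a
`p`-adic unit ⟹ the Euler-system half `Typed.MissingUpperBoundAt W p`.** The twist's `p ∤ ∏c(Wd)`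
is the Tamagawa transport at a Heegner field (`padicValNat_tamagawaProduct_twist_of_heegner`,
`p ≥ 5`), `p ∤ #Wd(ℚ)_tors` is irreducibility transported to the twist; then §1 and
`missingUpperBoundAt_of_classX11b_of_twistUnit_of_cha` (Cha 2005). Per pair; nothing booked.
[cite: Cha2005, Thm. 21 (p. 173)] [cite: Miller2011LMS, Thm. 5.2, §1 and Def. 1.1]
[cite: JetchevSkinnerWan2017, §7.4.1 (p. 30)] -/
theorem missingUpperBoundAt_of_classX11b_of_twistShaAnUnit_of_cha
    (hGZ : ∀ (N : ℕ) [NeZero N] (W : WeierstrassCurve ℚ) (K : Type) [Field K] [NumberField K],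
      gross_zagier N W K)
    (hKo : ∀ (N : ℕ) [NeZero N] (W : WeierstrassCurve ℚ) (K : Type) [Field K] [NumberField K],
      kolyvagin N W K)
    (hCha : thm52_padicValNat_shaOrder_le)
    (hGZK : rank_eq_analyticRank_of_analyticRank_le_one) (hmod : hasEntireLFunction_rat)
    (hnf : exists_isNewformOf) (hMaz : mazur_not_dvd_maninConstant_of_odd)
    (hX : ClassX11b W p) (hp5 : 5 ≤ p) (htam : ¬ p ∣ W.tamagawaProduct)
    (K : Type) [Field K] [NumberField K] (hK : IsImaginaryQuadratic K)
    (hHN : SatisfiesHeegnerHypothesis (W.conductorNorm ℤ) K) (hdK : NumberField.discr K < -4)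
    (Wd : WeierstrassCurve ℚ) [Wd.IsElliptic] [Wd.IsGloballyMinimal] (Cd : VariableChange ℚ)
    (hWd : Cd • W.quadraticTwist (NumberField.discr K : ℚ) = Wd) (hrd : Wd.analyticRank = 0)
    {sd : ℚ} (hsd : shaAn Wd = (sd : ℂ)) (hvsd : padicValRat p sd = 0) :
    Typed.MissingUpperBoundAt W p := by
  have hirrd : Wd.HasIrreducibleModPGaloisRep p :=
    hasIrreducibleModPGaloisRep_twist_model W p K hK.1 hX.2.2.2 Cd hWd
  have htamd : padicValNat p Wd.tamagawaProduct = 0 := by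
    rw [padicValNat_tamagawaProduct_twist_of_heegner W p hp5 K hK hHN Cd hWd]
    exact padicValNat.eq_zero_of_not_dvd htam
  obtain ⟨qd, hqd, hqd0, hvd⟩ :=
    exists_twistValue_of_shaAn_unit Wd p hGZK hmod hrd hirrd htamd hsd hvsd
  exact missingUpperBoundAt_of_classX11b_of_twistUnit_of_cha W p hGZ hKo hCha hGZK hmod hnf hMaz hX
    hp5 htam K hK hHN hdK Wd Cd hWd qd hqd hqd0 hvd

/-- **X11b ∧ `p ≥ 5` ∧ `ρ̄_{E,p}` onto ∧ `p ∤ ∏c(E)`: THE open input at the pair + a Heegner twist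
with `ord_{s=1} L(E^{d_K},s) = 0` and `p ∤ #Ш_an(E^{d_K})` ⟹ `BSD(E,p)` AND `BSD(E^{d_K},p)`**
(`P2.bsdp_and_bsdp_twist_of_openInputAt_of_twistUnit` with the certificate in the census column).
CONDITIONAL on the open input [UNREFEREED at `p ∥ N`: erratum (2.4) ⇐ FW21 4.41]; per pair; nothing
booked. [cite: McCallumLMS1991, §1 Theorem (Kolyvagin), p. 296] [cite: Castella2018Erratum, (2.4) (p. 1)]
[cite: JetchevSkinnerWan2017, §7.4.1 (pp. 30–31)] [cite: Miller2011LMS, Def. 1.1] -/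
theorem P2.bsdp_and_bsdp_twist_of_openInputAt_of_twistShaAnUnit
    (hGZ : ∀ (N : ℕ) [NeZero N] (W : WeierstrassCurve ℚ) (K : Type) [Field K] [NumberField K],
      gross_zagier N W K)
    (hKo : ∀ (N : ℕ) [NeZero N] (W : WeierstrassCurve ℚ) (K : Type) [Field K] [NumberField K],
      kolyvagin N W K)
    (hB : ∀ (N : ℕ) [NeZero N] (W : WeierstrassCurve ℚ) (K : Type) [Field K] [NumberField K],
      Kolyvagin1990_padicValNat_card_sha_le N W K)
    (hWu : sha_dvd_analyticSha)
    (hGZK : rank_eq_analyticRank_of_analyticRank_le_one) (hmod : hasEntireLFunction_rat)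
    (hnf : exists_isNewformOf) (hHL : HoffsteinLuo1997_exists_twist_L_one_ne_zero)
    (hMaz : mazur_not_dvd_maninConstant_of_odd)
    (hPT : ∀ (K : Type) [Field K] [NumberField K], poitouTate_sum_localTatePairing_eq_zero K)
    (hEP : ∀ (K : Type) [Field K] [NumberField K] (v : HeightOneSpectrum (𝓞 K)),
      localEulerPoincareCharacteristic (v.adicCompletion K))
    (hA : P2OpenInputOnTreeAt W p)
    (hX : ClassX11b W p) (hp5 : 5 ≤ p) (hsurj : Surj W p) (htam : ¬ p ∣ W.tamagawaProduct)
    (K : Type) [Field K] [NumberField K] (hK : IsImaginaryQuadratic K)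
    (hHN : SatisfiesHeegnerHypothesis (W.conductorNorm ℤ) K) (hdK : NumberField.discr K < -4)
    (Wd : WeierstrassCurve ℚ) [Wd.IsElliptic] [Wd.IsGloballyMinimal] (Cd : VariableChange ℚ)
    (hWd : Cd • W.quadraticTwist (NumberField.discr K : ℚ) = Wd) (hrd : Wd.analyticRank = 0)
    {sd : ℚ} (hsd : shaAn Wd = (sd : ℂ)) (hvsd : padicValRat p sd = 0) :
    BSDp W p ∧ BSDp Wd p := by
  have hirrd : Wd.HasIrreducibleModPGaloisRep p :=
    hasIrreducibleModPGaloisRep_twist_model W p K hK.1 hX.2.2.2 Cd hWd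
  have htamd : padicValNat p Wd.tamagawaProduct = 0 := by
    rw [padicValNat_tamagawaProduct_twist_of_heegner W p hp5 K hK hHN Cd hWd]
    exact padicValNat.eq_zero_of_not_dvd htam
  obtain ⟨qd, hqd, hqd0, hvd⟩ :=
    exists_twistValue_of_shaAn_unit Wd p hGZK hmod hrd hirrd htamd hsd hvsd
  exact P2.bsdp_and_bsdp_twist_of_openInputAt_of_twistUnit W p hGZ hKo hB hWu hGZK hmod hnf hHL hMaz
    hPT hEP hA hX hp5 hsurj htam K hK hHN hdK Wd Cd hWd qd hqd hqd0 hvd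

/-! ### §3. The per-pair closure in census columns: `p ∤ #Ш_an(E^{d_K})` and `p ∤ #Ш_an(E)` -/

/-- **PER-PAIR CLOSURE, BOTH certificates in the `#Ш_an` column, NO surjectivity, NO open input, NO
regulator.** On X11b ∧ `p ≥ 5` ∧ `p ∤ ∏c(E)`: a Heegner field `K` (`d_K < -4`), a globally minimal
model `Wd` of `E^{d_K}` with `ord_{s=1} L(Wd,s) = 0` and `#Ш_an(Wd) = s_d`, `ord_p s_d = 0`, and
`#Ш(E)_an = s` with `ord_p s ≤ 0` ⟹ `BSD(E,p)` (Cha 2005 + the Gross–Zagier identity). This is the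
kernel consumer of the census rows (label, `p`, `d`, `#Ш_an(E^d)`, `#Ш_an(E)`). Per pair; nothing
booked; X11b's label unchanged. [cite: Cha2005, Thm. 21 (p. 173)]
[cite: Miller2011LMS, Thm. 5.2, §1, Def. 1.1 and Prop. 7.6] [cite: JetchevSkinnerWan2017, §7.4.1 (p. 30)] -/
theorem bsdp_of_classX11b_of_twistShaAnUnit_of_padicValRat_shaAn_le_of_cha
    (hGZ : ∀ (N : ℕ) [NeZero N] (W : WeierstrassCurve ℚ) (K : Type) [Field K] [NumberField K],
      gross_zagier N W K)
    (hKo : ∀ (N : ℕ) [NeZero N] (W : WeierstrassCurve ℚ) (K : Type) [Field K] [NumberField K],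
      kolyvagin N W K)
    (hCha : thm52_padicValNat_shaOrder_le)
    (hGZK : rank_eq_analyticRank_of_analyticRank_le_one) (hmod : hasEntireLFunction_rat)
    (hnf : exists_isNewformOf) (hMaz : mazur_not_dvd_maninConstant_of_odd)
    (hX : ClassX11b W p) (hp5 : 5 ≤ p) (htam : ¬ p ∣ W.tamagawaProduct)
    (K : Type) [Field K] [NumberField K] (hK : IsImaginaryQuadratic K)
    (hHN : SatisfiesHeegnerHypothesis (W.conductorNorm ℤ) K) (hdK : NumberField.discr K < -4)
    (Wd : WeierstrassCurve ℚ) [Wd.IsElliptic] [Wd.IsGloballyMinimal] (Cd : VariableChange ℚ)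
    (hWd : Cd • W.quadraticTwist (NumberField.discr K : ℚ) = Wd) (hrd : Wd.analyticRank = 0)
    {sd : ℚ} (hsd : shaAn Wd = (sd : ℂ)) (hvsd : padicValRat p sd = 0)
    {s : ℚ} (hs : shaAn W = (s : ℂ)) (hv : padicValRat p s ≤ 0) : BSDp W p := by
  obtain ⟨q, hq, hle⟩ := missingUpperBoundAt_of_classX11b_of_twistShaAnUnit_of_cha W p hGZ hKo hCha
    hGZK hmod hnf hMaz hX hp5 htam K hK hHN hdK Wd Cd hWd hrd hsd hvsd
  have hqs : q = s := by exact_mod_cast hq.symm.trans hs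
  subst hqs
  exact bsdp_of_upper_of_padicValRat_shaAn_le W p hGZK (by rw [hX.1]) hq hle hv

end Pair

end Summit.BirchSwinnertonDyer.Rank1Residual.X11b

end
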